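import Mathlib.Tactic
import Literature.Computability.Complexity.Promise
import Literature.Computability.Cryptography.ClassBQP
import Literature.Algebra.EuclideanLattices.QuantumHardnessWall
import Summits.QuantumAdvantage.QuantumAdvantage.Statement
import Summits.QuantumAdvantage.QuantumAdvantage.Theorems.SoloInformedPseudoDeterministicLift
import Summits.QuantumAdvantage.QuantumAdvantage.Theorems.SoloInformedPromiseSepIffSummit
import Summits.QuantumAdvantage.QuantumAdvantage.Theorems.SoloInformedLiftDichotomy
import HarnessLib

/-!
# SoloInformedChainStrictness — the summit, the door and the promise separation as the strictness of one chain

Solo seat `solo-QuantumAdvantage-informed` (ideation tier, summit-directed). The three promise classes form a chain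
`PromiseBPP ⊆ promiseLift BQP ⊆ PromiseBQP` (`promiseBPP_subset_promiseLift_BQP`, file `SoloInformedLiftDichotomy`;
`promiseLift_BQP_subset_promiseBQP`, tree). This file records, kernel-checked and unconditional, that the three
statements of the programme are exactly the three strictness questions of that chain:

* `quantumAdvantage_iff_not_promiseLift_BQP_subset_PromiseBPP`, `quantumAdvantage_iff_PromiseBPP_ssubset_promiseLift_BQP`
  — **the summit `BQP ⊄ BPP` is the strictness of the FIRST inclusion** (equivalently: some promise problem is solved
  by a `BQP` language and by no `BPP` language, `quantumAdvantage_iff_exists_window`);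
* `not_promiseIsLift_iff_promiseLift_BQP_ssubset_PromiseBQP` — **`¬Q-EXT` is the strictness of the SECOND**;
* `promiseSep_iff_PromiseBPP_ssubset_PromiseBQP` — the promise separation `PromiseBQP ⊄ PromiseBPP` is the strictness of
  the composite; hence
* `promiseSep_iff_quantumAdvantage_or_not_promiseIsLift : PromiseBQP ⊄ PromiseBPP ↔ QuantumAdvantage ∨ ¬Q-EXT` —
  **the (`P ≠ PSPACE`-hard) promise separation splits EXACTLY as "summit, or the door is shut"**, with no overlap
  information lost: `A ⊊ C ⟺ A ⊊ B ∨ B ⊊ C` for a chain `A ⊆ B ⊆ C`.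

[cite: Goldreich2006, Def. 1.2 and §1.2] [cite: Watrous2009, §III.2] [cite: BernsteinVazirani1997, §8]
-/

noncomputable section

namespace Summit.QuantumAdvantage.QuantumAdvantage.Theorems

open _root_.Computability Literature.Computability.Complexity Literature.Computability.Cryptography
  Literature.Computability.QuantumComplexity

/-- **The summit is the non-emptiness of the window `promiseLift BQP ∖ PromiseBPP`**: `BQP ⊄ BPP` iff some promise
problem is solved by a `BQP` language and by no `BPP` language (`⇒`: the trivial-promise problem of the witness;
`⇐`: the solving `BQP` language cannot be in `BPP`). [cite: Goldreich2006, Def. 1.2] -/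
theorem quantumAdvantage_iff_exists_window :
    QuantumAdvantage ↔ ∃ Q : PromiseProblem, Q ∈ promiseLift BQP ∧ Q ∉ PromiseBPP := by
  constructor
  · rintro ⟨L, hL, hLB⟩
    refine ⟨PromiseProblem.ofLanguage L, ⟨L, hL, fun _ hx => hx, fun _ hx => hx⟩, ?_⟩
    rintro ⟨L', hL', hyes, hno⟩
    have hLL' : L = L' :=
      Set.ext fun x => ⟨fun hx => hyes hx, fun hx => by_contra fun hx' => hno hx' hx⟩
    exact hLB (hLL' ▸ hL')
  · rintro ⟨Q, ⟨L, hL, hyes, hno⟩, hQ⟩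
    refine ⟨L, hL, fun hLB => hQ ⟨L, hLB, hyes, hno⟩⟩

/-- **`BQP ⊄ BPP ⟺ ¬(promiseLift BQP ⊆ PromiseBPP)`** — the summit is the strictness of the first inclusion of the
chain `PromiseBPP ⊆ promiseLift BQP ⊆ PromiseBQP`. [cite: Goldreich2006, Def. 1.2] -/
theorem quantumAdvantage_iff_not_promiseLift_BQP_subset_PromiseBPP :
    QuantumAdvantage ↔ ¬ promiseLift BQP ⊆ PromiseBPP := by
  rw [quantumAdvantage_iff_exists_window, Set.not_subset]

/-- The same with strict inclusion: **`BQP ⊄ BPP ⟺ PromiseBPP ⊊ promiseLift BQP`**. [cite: Goldreich2006, Def. 1.2] -/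
theorem quantumAdvantage_iff_PromiseBPP_ssubset_promiseLift_BQP :
    QuantumAdvantage ↔ PromiseBPP ⊂ promiseLift BQP := by
  rw [quantumAdvantage_iff_not_promiseLift_BQP_subset_PromiseBPP, Set.ssubset_def]
  exact ⟨fun h => ⟨promiseBPP_subset_promiseLift_BQP, h⟩, fun h => h.2⟩

/-- **`¬Q-EXT ⟺ promiseLift BQP ⊊ PromiseBQP`** — the door is the strictness of the second inclusion.
[cite: Goldreich2006, Def. 1.2] [cite: Watrous2009, §III.2] -/
theorem not_promiseIsLift_iff_promiseLift_BQP_ssubset_PromiseBQP :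
    ¬ PromiseBQP ⊆ promiseLift BQP ↔ promiseLift BQP ⊂ PromiseBQP := by
  rw [Set.ssubset_def]
  exact ⟨fun h => ⟨Literature.Algebra.EuclideanLattices.promiseLift_BQP_subset_promiseBQP, h⟩, fun h => h.2⟩

/-- **`PromiseBQP ⊄ PromiseBPP ⟺ PromiseBPP ⊊ PromiseBQP`** — the promise separation is the strictness of the
composite inclusion. [cite: Goldreich2006, Def. 1.2] [cite: Watrous2009, §III.2] -/
theorem promiseSep_iff_PromiseBPP_ssubset_PromiseBQP :
    ¬ PromiseBQP ⊆ PromiseBPP ↔ PromiseBPP ⊂ PromiseBQP := by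
  rw [Set.ssubset_def]
  exact ⟨fun h => ⟨promiseBPP_subset_promiseLift_BQP.trans
    Literature.Algebra.EuclideanLattices.promiseLift_BQP_subset_promiseBQP, h⟩, fun h => h.2⟩

/-- **The promise separation splits exactly as "summit, or the door is shut"**:
`PromiseBQP ⊄ PromiseBPP ↔ QuantumAdvantage ∨ ¬Q-EXT` (`A ⊊ C ⟺ A ⊊ B ∨ B ⊊ C` on the chain). `⇒` is
`quantumAdvantage_or_not_promiseIsLift_of_promiseSep`; `⇐` is `promiseSep_of_quantumAdvantage` /
`promiseSep_of_not_promiseIsLift`. [cite: Goldreich2006, Def. 1.2] [cite: BernsteinVazirani1997, §8] -/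
theorem promiseSep_iff_quantumAdvantage_or_not_promiseIsLift :
    ¬ PromiseBQP ⊆ PromiseBPP ↔ QuantumAdvantage ∨ ¬ PromiseBQP ⊆ promiseLift BQP :=
  ⟨quantumAdvantage_or_not_promiseIsLift_of_promiseSep,
    fun h => h.elim promiseSep_of_quantumAdvantage promiseSep_of_not_promiseIsLift⟩

/-- Lattice form of the split: `PromiseBPP ⊊ PromiseBQP ↔ PromiseBPP ⊊ promiseLift BQP ∨ promiseLift BQP ⊊ PromiseBQP`.
[cite: Goldreich2006, Def. 1.2] -/
theorem PromiseBPP_ssubset_PromiseBQP_iff :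
    PromiseBPP ⊂ PromiseBQP ↔ PromiseBPP ⊂ promiseLift BQP ∨ promiseLift BQP ⊂ PromiseBQP := by
  rw [← promiseSep_iff_PromiseBPP_ssubset_PromiseBQP, ← quantumAdvantage_iff_PromiseBPP_ssubset_promiseLift_BQP,
    ← not_promiseIsLift_iff_promiseLift_BQP_ssubset_PromiseBQP]
  exact promiseSep_iff_quantumAdvantage_or_not_promiseIsLift

end Summit.QuantumAdvantage.QuantumAdvantage.Theorems

end
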